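import Literature.AnabelianGeometry.EtaleTheta.Discharge.Sec2DiscreteNormalizers
import Literature.GroupTheory.CombinatorialGroupTheory.FreeGroupConjugacySeparable

/-!
# [EtTh] Lemma 2.17 (i): discharging the printed input (b) "Stebe" by name

Mochizuki, *The Étale Theta Function and its Frobenioid-theoretic Manifestations* [EtTh],
Publ. RIMS 45 (2009), §2, Lemma 2.17 (i), PRIMS text pp.58–59 (printed pp.284–285; bib key
`MochizukiEtTh2009`).  The proof of Lemma 2.17 (i) invokes "a classical result of P. Stebe [cf.
[LynSch], Proposition 4.9]" — conjugacy separability of free groups (p.59).  That input is now a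
THEOREM of the tree (`FreeGroup.conjugacySeparable`, abc-iut-L5-t14,
`GroupTheory/CombinatorialGroupTheory/FreeGroupConjugacySeparable.lean`); this PROOF-ONLY file
(no definitions) repackages it in the shape consumed by `lem217_i_of_facts`
(`Discharge/Sec2DiscreteNormalizers.lean`) and records Lemma 2.17 (i) modulo the two remaining
printed inputs: (a) [SemiAnbd] Cor. 1.6 (ii) (tree FACT `SemiGraphs.corollary_1_6_ii`) and (c) the
pro-cyclicity of centralizers of free generators in the profinite completion ([CombGC] Prop. 1.2
(ii) as cited on p.285; abc-iut-L5-d2's `centralizer_eta_basis_le_closure_zpowers`, to be plugged in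
the same way when it lands).

Honest framing: classical group theory; nothing here concerns [IUTchIII] Cor. 3.12; typed ≠
discharged — Lemma 2.17 (i) is discharged here MODULO (a) and (c).
-/

namespace Literature.AnabelianGeometry.EtaleTheta.DiscreteNormalizers

open CategoryTheory ProfiniteGrp ProfiniteGrp.ProfiniteCompletion

universe u

/-- P. Stebe's conjugacy separability of free groups (tree theorem `FreeGroup.conjugacySeparable`,
[LynSch] Prop. I.4.8) in the shape over Mathlib's `FiniteIndexNormalSubgroup` consumed by
`lem217_i_of_facts`: non-conjugate elements of a free group stay non-conjugate in some finite
quotient. [cite: MochizukiEtTh2009, Lem 2.17(i) p.59] -/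
theorem stebe_finiteIndexNormalSubgroup :
    ∀ (κ : Type u) (u v : FreeGroup κ), ¬ IsConj u v →
      ∃ K : FiniteIndexNormalSubgroup (FreeGroup κ),
        ¬ IsConj (QuotientGroup.mk u : FreeGroup κ ⧸ K.toSubgroup) (QuotientGroup.mk v) := by
  intro κ u v h
  obtain ⟨K, hKn, hKf, hK⟩ := FreeGroup.conjugacySeparable κ u v h
  exact ⟨FiniteIndexNormalSubgroup.ofSubgroup K, hK⟩

/-- **[EtTh] Lemma 2.17 (i)** in the typed shape of `ThetaCovers.TemperedCoverData.Lem217_i`, with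
the printed input (b) "Stebe" DISCHARGED by the tree theorem `FreeGroup.conjugacySeparable`; the
remaining hypotheses are the printed inputs (a) [SemiAnbd] Cor. 1.6 (ii) (`hHall`, tree FACT
`SemiGraphs.corollary_1_6_ii`) and (c) the centralizer of a free generator in the profinite completion
(`hCent`, [CombGC] Prop. 1.2 (ii) as cited on p.285).
[cite: MochizukiEtTh2009, Lem 2.17(i) pp.58–59] -/
theorem lem217_i_of_hall_of_cent
    (hHall : SemiGraphs.corollary_1_6_ii.{u})
    (hCent : ∀ (J : Type u) [Group J] (κ : Type u) (β : FreeGroupBasis κ J) (i : κ),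
      let η : J →* ProfiniteGrp.ProfiniteCompletion.completion (GrpCat.of J) :=
        (ProfiniteGrp.ProfiniteCompletion.eta (GrpCat.of J)).hom
      Subgroup.centralizer {η (β i)} ≤ (Subgroup.zpowers (η (β i))).topologicalClosure) :
    ∀ (F : Type u) [Group F] (G H : Subgroup F) [IsFreeGroup G], G.Normal → G.FiniteIndex →
      Finite (IsFreeGroup.Generators G) → (∃ a ∈ H ⊓ G, ∃ b ∈ H ⊓ G, a * b ≠ b * a) →
      let η : F →* ProfiniteGrp.ProfiniteCompletion.completion (GrpCat.of F) :=
        (ProfiniteGrp.ProfiniteCompletion.eta (GrpCat.of F)).hom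
      Subgroup.normalizer ((H.map η : Subgroup _) : Set _) =
        (Subgroup.normalizer (H : Set F)).map η :=
  lem217_i_of_facts hHall stebe_finiteIndexNormalSubgroup hCent

end Literature.AnabelianGeometry.EtaleTheta.DiscreteNormalizers
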